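import Summits.AnomalousDissipation.AnomalousDissipation.Theorems.TwoAndHalfDTwohalfdNegCondensateSelection
import Summits.AnomalousDissipation.AnomalousDissipation.Theorems.TwoAndHalfDTwohalfdNegCondensateWeakLimit
import Summits.AnomalousDissipation.AnomalousDissipation.Theorems.TwoAndHalfDTwohalfdNegCondensateRenormalisation

/-!
# Condensate theorem for the crux `TwoAndHalfD.TwohalfdNeg` (stmt-AnomalousDissipation-0211), layer 2:
# condensation of the planar flow onto a smooth steady field kills the steady-source scalar anomaly

Line `log-kantorovich-enstrophy-transfer`, lead c6.  The item's informal mechanism ("the 2-D base flow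
condenses to a near-steady state whose streamline-averaged scalar source is not annihilated ⇒ scalar energy
blows up unless dissipation is merely enhanced, not anomalous") made a theorem, in a sharper geometry-free form:

* `scalarNoAnomaly_of_condensate` (planar form): `g` smooth mean-zero steady force, `h` smooth mean-zero steady
  source, `V` smooth divergence-free STEADY field, `ν_j → 0`, `v_j` global Leray–Hopf (planar NS forced by `g`),
  `θ_j` global weak sourced scalars over `v_j` with `ν`-uniformly bounded `limsup`-mean variance, and
  CONDENSATION `⟨‖v_j − V‖²_{L²}⟩ → 0` ⇒ `⟨ν_j‖∇θ_j‖²⟩ → 0`.  No energy or strain hypothesis on `v_j` (the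
  fluctuation may be arbitrarily rough), no streamline geometry: were the dissipation `≥ ε` along a subsequence,
  layer 1 (`exists_approxSolution`) gives bounded weighted Cesàro means `Θ_k ∈ L²` with power `≥ ε/4` solving
  `div(Θ_k V) = h` up to `o(1)`, a weak limit solves it exactly with `∫Θ'h ≥ ε/4` (stub F,
  `stub_condensateWeakLimit`), and DiPerna–Lions renormalisation for the Lipschitz `V` gives `∫Θ'h = 0` (stub G,
  `stub_condensateRenormalisation`).
* `twohalfdNeg_family_of_condensate` (crux form): the crux `TwohalfdNeg` restricted to bounded-energy
  `x₃`-invariant global Leray–Hopf families whose planar velocity condenses onto some smooth steady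
  divergence-free `V` (`⟨∫‖π_E u_j − V∘π‖²⟩ → 0`): `meanDissipation → 0` (reduction S1' + Alexakis–Doering S2 +
  the planar form; the `limsup` means do not see `t = 0`).

Both branches of the informal mechanism drop out: where `V·∇Θ = h` has no `L²` solution (stagnant pocket,
non-annihilated streamline average of `h`) no bounded-variance condensing family exists; where it has one the
anomaly vanishes.  Orthogonal to the line's residual S6 (`stub_subLogStrain`, sub-logarithmic mean strain): an
`X`-witness of the sibling crux 0448 must be non-condensing (positive `liminf` fluctuation energy around EVERY
smooth steady divergence-free planar field) and have mean strain `≳ log(1/ν_j)`.  Closes with the registered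
tools stub `stub_condensateCertificate`.  Supports stmt-AnomalousDissipation-0211.
-/

namespace Summit.AnomalousDissipation.AnomalousDissipation.Theorems.TwohalfdNeg.Condensate

open MeasureTheory Filter Topology Set
open scoped ENNReal NNReal InnerProductSpace
open Literature.Analysis.FunctionSpaces Literature.Analysis.FluidPDE
open Summit.AnomalousDissipation.AnomalousDissipation.Theorems.TwohalfdNeg

set_option linter.dupNamespace false
/-! ## Layer 2: the planar condensate theorem -/

/-- **The planar condensate theorem, renormalisation abstracted.** As `scalarNoAnomaly_of_condensate`
below, for a merely CONTINUOUS steady field `V`, granted the steady renormalisation property of `V`: every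
`L²` distributional solution `Θ'` of `div(Θ'V) = h` has `∫Θ'h = 0` (for smooth divergence-free `V` this is the
registered stub `stub_condensateRenormalisation`, DiPerna–Lions). [folklore] -/
theorem scalarNoAnomaly_of_condensate_of_renorm :
    ∀ (g : UnitAddTorus (Fin 2) → EuclideanSpace ℝ (Fin 2)) (h : UnitAddTorus (Fin 2) → ℝ)
      (V : UnitAddTorus (Fin 2) → EuclideanSpace ℝ (Fin 2)),
      Torus.IsSmooth g → Torus.HasZeroMean g → Torus.IsSmooth h → Torus.HasZeroMean h →
      Continuous V →
      (∀ Θ' : UnitAddTorus (Fin 2) → ℝ, MemLp Θ' 2 volume →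
        (∀ φ : UnitAddTorus (Fin 2) → ℝ, Torus.IsSmooth φ →
          (∫ x, Θ' x * inner ℝ (V x) (Torus.gradient φ x)) + ∫ x, h x * φ x = 0) →
        ∫ x, Θ' x * h x = 0) →
      ∀ (ν : ℕ → ℝ) (v₀ : ℕ → UnitAddTorus (Fin 2) → EuclideanSpace ℝ (Fin 2))
        (v : ℕ → ℝ → UnitAddTorus (Fin 2) → EuclideanSpace ℝ (Fin 2))
        (θ₀ : ℕ → UnitAddTorus (Fin 2) → ℝ) (θ : ℕ → ℝ → UnitAddTorus (Fin 2) → ℝ),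
        (∀ j, 0 < ν j) → Tendsto ν atTop (𝓝 0) →
        (∀ j, Torus.IsGlobalLerayHopf (ν j) (fun _ => g) (v₀ j) (v j)) →
        Tendsto (fun j => longTimeAvgSup (fun t => ∫ x, ‖v j t x - V x‖ ^ 2)) atTop (𝓝 0) →
        (∀ j, MemLp (θ₀ j) 2 volume) →
        (∀ j, Torus.IsWeakScalarTransportForced (ν j) (v j) (fun _ => h) (θ₀ j) (θ j)) →
        (∃ E : ℝ, ∀ j, longTimeAvgSup (fun t => Torus.scalarL2Sq (θ j t)) ≤ E) →
        Tendsto (fun j => longTimeAvgSup (fun t => ν j * (Torus.eScalarGradNormSq (θ j t)).toReal))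
          atTop (𝓝 0) := by
  intro g h V hgs hgz hhs hhz hVc hR ν v₀ v θ₀ θ hν hν0 hLH hcond hθ₀ hθw hEθ
  obtain ⟨Eθ, hEθ⟩ := hEθ
  by_contra hnt
  -- an anomaly floor along a subsequence
  have hfreq : ∃ ε : ℝ, 0 < ε ∧ ∃ᶠ j in atTop,
      ε ≤ longTimeAvgSup (fun t => ν j * (Torus.eScalarGradNormSq (θ j t)).toReal) := by
    by_contra hall
    push Not at hall
    apply hnt
    rw [tendsto_order]
    refine ⟨fun b hb => Eventually.of_forall fun j => hb.trans_le ?_, fun b hb => hall b hb⟩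
    exact longTimeAvgSup_nonneg fun t => mul_nonneg (hν j).le ENNReal.toReal_nonneg
  obtain ⟨ε, hε, hfr⟩ := hfreq
  obtain ⟨φ, hφ, hφε⟩ := extraction_of_frequently_atTop hfr
  -- tolerances along the subsequence
  have hW0 : ∀ j, 0 ≤ longTimeAvgSup (fun t => ∫ x, ‖v j t x - V x‖ ^ 2) := fun j =>
    longTimeAvgSup_nonneg fun t => integral_nonneg fun _ => sq_nonneg _
  set δ : ℕ → ℝ := fun k => longTimeAvgSup (fun t => ∫ x, ‖v (φ k) t x - V x‖ ^ 2) + 1 / ((k : ℝ) + 1)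
    with hδ
  have hδ0 : ∀ k, 0 < δ k := fun k => add_pos_of_nonneg_of_pos (hW0 _) (by positivity)
  have hδlim : Tendsto δ atTop (𝓝 0) := by
    have h1 : Tendsto (fun k => longTimeAvgSup (fun t => ∫ x, ‖v (φ k) t x - V x‖ ^ 2)) atTop (𝓝 0) :=
      hcond.comp hφ.tendsto_atTop
    have h2 := h1.add (tendsto_one_div_add_atTop_nhds_zero_nat (𝕜 := ℝ))
    rw [add_zero] at h2
    exact h2
  set η : ℕ → ℝ := fun k => max (ν (φ k)) (Real.sqrt (δ k)) with hη
  have hη0 : ∀ k, 0 < η k := fun k => (hν _).trans_le (le_max_left _ _)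
  have hηlim : Tendsto η atTop (𝓝 0) := by
    have h1 : Tendsto (fun k => ν (φ k)) atTop (𝓝 0) := hν0.comp hφ.tendsto_atTop
    have h2 : Tendsto (fun k => Real.sqrt (δ k)) atTop (𝓝 0) := by
      simpa using hδlim.sqrt
    simpa using h1.max h2
  -- layer 1 at every level of the subsequence
  have hlev : ∀ k, ∃ Θ : UnitAddTorus (Fin 2) → ℝ, MemLp Θ 2 volume ∧ ∫ x, Θ x ^ 2 ≤ 2 * (Eθ + 1) ∧
      ε / 4 ≤ ∫ x, Θ x * h x ∧
      ∀ (ψ : UnitAddTorus (Fin 2) → ℝ) (Cφ Cg Cl : ℝ), Torus.IsSmooth ψ → (∀ x, |ψ x| ≤ Cφ) →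
        (∀ x, ‖Torus.gradient ψ x‖ ≤ Cg) → (∀ x, |Torus.laplacian ψ x| ≤ Cl) →
        |(∫ x, Θ x * ⟪V x, Torus.gradient ψ x⟫_ℝ) + ∫ x, h x * ψ x| ≤
          η k * ((Cφ + Cg + Cl) * (Eθ + 1 + 2)) := fun k => by
    refine exists_approxSolution (hν (φ k)) hgs hgz (hLH (φ k)) hVc hhs hhz (hθ₀ (φ k))
      (hθw (φ k)) (δ := δ k) (by positivity) ?_ ?_ ?_ (hη0 k) (le_max_left _ _) ?_
    · have := hφε k; linarith
    · exact (hEθ (φ k)).trans_lt (lt_add_one _)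
    · show longTimeAvgSup (fun t => ∫ x, ‖v (φ k) t x - V x‖ ^ 2) < δ k
      rw [hδ]; simp only; linarith [one_div_pos.2 (by positivity : (0 : ℝ) < (k : ℝ) + 1)]
    · calc δ k = Real.sqrt (δ k) ^ 2 := (Real.sq_sqrt (hδ0 k).le).symm
        _ ≤ η k ^ 2 := pow_le_pow_left₀ (Real.sqrt_nonneg _) (le_max_right _ _) 2
  choose Θ hΘm hΘsq hΘh hΘeq using hlev
  -- the error in the steady transport equation tends to zero
  have happrox : ∀ ψ : UnitAddTorus (Fin 2) → ℝ, Torus.IsSmooth ψ →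
      Tendsto (fun k => (∫ x, Θ k x * inner ℝ (V x) (Torus.gradient ψ x)) + ∫ x, h x * ψ x)
        atTop (𝓝 0) := by
    intro ψ hψ
    obtain ⟨Cφ, hCφ⟩ : ∃ C : ℝ, ∀ x, |ψ x| ≤ C := by
      obtain ⟨C, hC⟩ := Torus.exists_forall_norm_le_of_continuous hψ.continuous
      exact ⟨C, fun x => (Real.norm_eq_abs (ψ x)) ▸ hC x⟩
    obtain ⟨Cg, hCg⟩ : ∃ C : ℝ, ∀ x, ‖Torus.gradient ψ x‖ ≤ C :=
      Torus.exists_forall_norm_le_of_continuous hψ.gradient.continuous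
    obtain ⟨Cl, hCl⟩ : ∃ C : ℝ, ∀ x, |Torus.laplacian ψ x| ≤ C := by
      obtain ⟨C, hC⟩ := Torus.exists_forall_norm_le_of_continuous hψ.laplacian.continuous
      exact ⟨C, fun x => (Real.norm_eq_abs (Torus.laplacian ψ x)) ▸ hC x⟩
    refine squeeze_zero_norm (fun k => ?_) (by simpa using hηlim.mul_const ((Cφ + Cg + Cl) * (Eθ + 1 + 2)))
    rw [Real.norm_eq_abs]
    exact hΘeq k ψ Cφ Cg Cl hψ hCφ hCg hCl
  -- weak limit and renormalisation
  obtain ⟨Θ', hΘ'm, hΘ'h, hΘ'eq⟩ := stub_condensateWeakLimit V h Θ (2 * (Eθ + 1)) (ε / 4) hVc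
    hhs.continuous hΘm hΘsq hΘh happrox
  have h0 := hR Θ' hΘ'm hΘ'eq
  linarith

/-- **Condensation onto a smooth steady planar field kills the steady-source scalar anomaly (planar form).**
Let `g` be a smooth mean-zero steady force and `h` a smooth mean-zero steady source on `T²`, `V` a smooth
divergence-free steady field, `ν_j > 0` with `ν_j → 0`, `v_j` global Leray–Hopf solutions of the planar
Navier–Stokes equations forced by `g` which CONDENSE onto `V` in `limsup`-mean `L²`,
`⟨‖v_j − V‖²_{L²}⟩ → 0`, and `θ_j` global weak sourced scalars over `v_j` (`Pr = 1`, `L²` data) with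
`ν`-uniformly bounded `limsup`-mean variance.  Then the `limsup`-mean scalar dissipation tends to `0`:
`⟨ν_j‖∇θ_j‖²⟩ → 0`.  Proof: were it `≥ ε` along a subsequence, layer 1 would give weighted Cesàro means
`Θ_k ∈ L²`, bounded, with power `∫Θ_k h ≥ ε/4`, solving `div(Θ_k V) = h` up to `o(1)`; a weak limit
`Θ'` (stub F) solves it exactly with `∫Θ' h ≥ ε/4`, while DiPerna–Lions renormalisation (stub G) gives
`∫Θ' h = 0`.  No strain hypothesis, no energy bound on `v_j`, no streamline geometry. [folklore] -/
theorem scalarNoAnomaly_of_condensate :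
    ∀ (g : UnitAddTorus (Fin 2) → EuclideanSpace ℝ (Fin 2)) (h : UnitAddTorus (Fin 2) → ℝ)
      (V : UnitAddTorus (Fin 2) → EuclideanSpace ℝ (Fin 2)),
      Torus.IsSmooth g → Torus.HasZeroMean g → Torus.IsSmooth h → Torus.HasZeroMean h →
      Torus.IsSmooth V → Torus.IsDivFree V →
      ∀ (ν : ℕ → ℝ) (v₀ : ℕ → UnitAddTorus (Fin 2) → EuclideanSpace ℝ (Fin 2))
        (v : ℕ → ℝ → UnitAddTorus (Fin 2) → EuclideanSpace ℝ (Fin 2))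
        (θ₀ : ℕ → UnitAddTorus (Fin 2) → ℝ) (θ : ℕ → ℝ → UnitAddTorus (Fin 2) → ℝ),
        (∀ j, 0 < ν j) → Tendsto ν atTop (𝓝 0) →
        (∀ j, Torus.IsGlobalLerayHopf (ν j) (fun _ => g) (v₀ j) (v j)) →
        Tendsto (fun j => longTimeAvgSup (fun t => ∫ x, ‖v j t x - V x‖ ^ 2)) atTop (𝓝 0) →
        (∀ j, MemLp (θ₀ j) 2 volume) →
        (∀ j, Torus.IsWeakScalarTransportForced (ν j) (v j) (fun _ => h) (θ₀ j) (θ j)) →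
        (∃ E : ℝ, ∀ j, longTimeAvgSup (fun t => Torus.scalarL2Sq (θ j t)) ≤ E) →
        Tendsto (fun j => longTimeAvgSup (fun t => ν j * (Torus.eScalarGradNormSq (θ j t)).toReal))
          atTop (𝓝 0) :=
  fun g h V hgs hgz hhs hhz hVs hVd =>
    scalarNoAnomaly_of_condensate_of_renorm g h V hgs hgz hhs hhz hVs.continuous
      fun Θ' hΘ'm hΘ'eq => stub_condensateRenormalisation V h Θ' hVs hVd hhs hΘ'm hΘ'eq

/-! ## The crux on condensing `x₃`-invariant families -/

/-- The planar fluctuation energy of an `x₃`-invariant field read on `T³`: for `u = twoHalf w r`,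
`∫_{T³} ‖π_E u − V ∘ π‖² = ∫_{T²} ‖w − V‖²`. [folklore] -/
theorem integral_norm_sq_planarProjE_twoHalf_sub {w V : UnitAddTorus (Fin 2) → EuclideanSpace ℝ (Fin 2)}
    (r : UnitAddTorus (Fin 2) → ℝ) (hw : AEStronglyMeasurable w volume) (hV : Continuous V) :
    ∫ x, ‖Torus.planarProjE (Torus.twoHalf w r x) - V (Torus.planarProj x)‖ ^ 2 =
      ∫ y, ‖w y - V y‖ ^ 2 := by
  have e : (fun x => ‖Torus.planarProjE (Torus.twoHalf w r x) - V (Torus.planarProj x)‖ ^ 2) =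
      fun x => (fun y => ‖w y - V y‖ ^ 2) (Torus.planarProj x) := by
    funext x
    simp only [Torus.twoHalf, Torus.planarProjE_planarEmbed]
  rw [e]
  exact Torus.integral_comp_planarProj ((hw.sub hV.aestronglyMeasurable).norm.pow 2)

/-- **The crux `TwohalfdNeg` on condensing families.** For an `x₃`-invariant smooth divergence-free
mean-zero steady force `f` on `T³`, a smooth divergence-free steady planar field `V`, and a family of
`x₃`-invariant global Leray–Hopf solutions `u_j` of NS_{ν_j}, `ν_j → 0`, arbitrary `L²` data, with
`ν`-uniformly bounded `limsup`-mean energy, WHOSE PLANAR VELOCITY CONDENSES ONTO `V` in `limsup`-mean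
`L²` — `⟨∫_{T³}‖π_E u_j − V ∘ π‖²⟩ → 0` — the mean dissipation tends to `0`.  Reduction S1'
(`ReductionOffZero.stub_reductionOffZero`: `f = twoHalf g h`, `u_j(t) = twoHalf (v_j t) (θ_j t)` for
`t ≠ 0`, bounded-energy planar Leray–Hopf `v_j`, bounded-variance weak sourced scalars `θ_j`), the planar
energy half S2 (`PlanarNoAnomaly.stub_planarNoAnomaly`, Alexakis–Doering), and the planar condensate
theorem `scalarNoAnomaly_of_condensate` for the scalar half (the condensation hypothesis transfers to `v_j`
because the `limsup` means do not see `t = 0`). This certifies the item's informal mechanism ("the 2-D base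
flow condenses to a near-steady state …") as a sub-case of the crux, with no streamline geometry. [folklore] -/
theorem twohalfdNeg_family_of_condensate :
    ∀ f : UnitAddTorus (Fin 3) → EuclideanSpace ℝ (Fin 3),
      (∀ (s : UnitAddCircle) (x : UnitAddTorus (Fin 3)), f (x + Pi.single (2 : Fin 3) s) = f x) →
      Torus.IsSmooth f → Torus.IsDivFree f → Torus.HasZeroMean f →
      ∀ V : UnitAddTorus (Fin 2) → EuclideanSpace ℝ (Fin 2), Torus.IsSmooth V → Torus.IsDivFree V →
      ∀ (ν : ℕ → ℝ) (u₀ : ℕ → UnitAddTorus (Fin 3) → EuclideanSpace ℝ (Fin 3))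
        (u : ℕ → ℝ → UnitAddTorus (Fin 3) → EuclideanSpace ℝ (Fin 3)),
        (∀ j, 0 < ν j) → Tendsto ν atTop (𝓝 0) →
        (∀ j, Torus.IsGlobalLerayHopf (ν j) (fun _ => f) (u₀ j) (u j)) →
        (∀ j (t : ℝ) (s : UnitAddCircle) (x : UnitAddTorus (Fin 3)),
          u j t (x + Pi.single (2 : Fin 3) s) = u j t x) →
        (∃ E : ℝ, ∀ j, meanEnergy (u j) ≤ E) →
        Tendsto (fun j => longTimeAvgSup (fun t =>
          ∫ x, ‖Torus.planarProjE (u j t x) - V (Torus.planarProj x)‖ ^ 2)) atTop (𝓝 0) →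
        Tendsto (fun j => meanDissipation (ν j) (u j)) atTop (𝓝 0) := by
  intro f hfinv hfs hfd hfz V hVs hVd ν u₀ u hν hν0 hLH huinv hE hcond
  obtain ⟨g, h, v₀, v, θ₀, θ, hgs, hgd, hgz, hhs, hhz, -, huv, hvLH, hθ₀, hθw, hEv, hEθ, hsplit⟩ :=
    ReductionOffZero.stub_reductionOffZero f hfinv hfs hfd hfz ν u₀ u hν hLH huinv hE
  have hplanar : Tendsto (fun j => meanDissipation (ν j) (v j)) atTop (𝓝 0) :=
    PlanarNoAnomaly.stub_planarNoAnomaly g hgs hgd hgz ν v₀ v hν hν0 hvLH hEv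
  -- the condensation hypothesis read on the planar flow
  have hcond' : Tendsto (fun j => longTimeAvgSup (fun t => ∫ y, ‖v j t y - V y‖ ^ 2)) atTop (𝓝 0) := by
    refine hcond.congr fun j => ?_
    unfold longTimeAvgSup
    refine limsup_congr ?_
    filter_upwards [eventually_gt_atTop (0 : ℝ)] with T hT
    unfold timeMean
    congr 1
    refine intervalIntegral.integral_congr_ae (Eventually.of_forall fun t ht => ?_)
    rw [Set.uIoc_of_le hT.le] at ht
    rw [huv j t ht.1.ne']
    exact integral_norm_sq_planarProjE_twoHalf_sub (θ j t)
      (((hvLH j) (t + 1) (by linarith [ht.1])).memLp t ⟨ht.1.le, by linarith⟩).1 hVs.continuous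
  have hscalar : Tendsto (fun j => longTimeAvgSup
      (fun t => ν j * (Torus.eScalarGradNormSq (θ j t)).toReal)) atTop (𝓝 0) :=
    scalarNoAnomaly_of_condensate g h V hgs hgz hhs hhz hVs hVd ν v₀ v θ₀ θ hν hν0 hvLH hcond' hθ₀ hθw hEθ
  have hsum : Tendsto (fun j => meanDissipation (ν j) (v j) +
      longTimeAvgSup (fun t => ν j * (Torus.eScalarGradNormSq (θ j t)).toReal)) atTop (𝓝 0) := by
    simpa using hplanar.add hscalar
  exact squeeze_zero (fun j => meanDissipation_nonneg (hν j).le (u j)) hsplit hsum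

/-- **Registered tools stub `stub_condensateCertificate`** (layer 2 of the condensate theorem, registered on
stmt-AnomalousDissipation-0211 with `ledger workitem stub-add`): the planar condensate theorem and the crux on
condensing `x₃`-invariant families. [folklore] -/
theorem stub_condensateCertificate :
    (∀ (g : UnitAddTorus (Fin 2) → EuclideanSpace ℝ (Fin 2)) (h : UnitAddTorus (Fin 2) → ℝ)
      (V : UnitAddTorus (Fin 2) → EuclideanSpace ℝ (Fin 2)),
      Torus.IsSmooth g → Torus.HasZeroMean g → Torus.IsSmooth h → Torus.HasZeroMean h →
      Torus.IsSmooth V → Torus.IsDivFree V →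
      ∀ (ν : ℕ → ℝ) (v₀ : ℕ → UnitAddTorus (Fin 2) → EuclideanSpace ℝ (Fin 2))
        (v : ℕ → ℝ → UnitAddTorus (Fin 2) → EuclideanSpace ℝ (Fin 2))
        (θ₀ : ℕ → UnitAddTorus (Fin 2) → ℝ) (θ : ℕ → ℝ → UnitAddTorus (Fin 2) → ℝ),
        (∀ j, 0 < ν j) → Tendsto ν atTop (𝓝 0) →
        (∀ j, Torus.IsGlobalLerayHopf (ν j) (fun _ => g) (v₀ j) (v j)) →
        Tendsto (fun j => longTimeAvgSup (fun t => ∫ x, ‖v j t x - V x‖ ^ 2)) atTop (𝓝 0) →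
        (∀ j, MemLp (θ₀ j) 2 volume) →
        (∀ j, Torus.IsWeakScalarTransportForced (ν j) (v j) (fun _ => h) (θ₀ j) (θ j)) →
        (∃ E : ℝ, ∀ j, longTimeAvgSup (fun t => Torus.scalarL2Sq (θ j t)) ≤ E) →
        Tendsto (fun j => longTimeAvgSup (fun t => ν j * (Torus.eScalarGradNormSq (θ j t)).toReal))
          atTop (𝓝 0)) ∧
    (∀ f : UnitAddTorus (Fin 3) → EuclideanSpace ℝ (Fin 3),
      (∀ (s : UnitAddCircle) (x : UnitAddTorus (Fin 3)), f (x + Pi.single (2 : Fin 3) s) = f x) →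
      Torus.IsSmooth f → Torus.IsDivFree f → Torus.HasZeroMean f →
      ∀ V : UnitAddTorus (Fin 2) → EuclideanSpace ℝ (Fin 2), Torus.IsSmooth V → Torus.IsDivFree V →
      ∀ (ν : ℕ → ℝ) (u₀ : ℕ → UnitAddTorus (Fin 3) → EuclideanSpace ℝ (Fin 3))
        (u : ℕ → ℝ → UnitAddTorus (Fin 3) → EuclideanSpace ℝ (Fin 3)),
        (∀ j, 0 < ν j) → Tendsto ν atTop (𝓝 0) →
        (∀ j, Torus.IsGlobalLerayHopf (ν j) (fun _ => f) (u₀ j) (u j)) →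
        (∀ j (t : ℝ) (s : UnitAddCircle) (x : UnitAddTorus (Fin 3)),
          u j t (x + Pi.single (2 : Fin 3) s) = u j t x) →
        (∃ E : ℝ, ∀ j, meanEnergy (u j) ≤ E) →
        Tendsto (fun j => longTimeAvgSup (fun t =>
          ∫ x, ‖Torus.planarProjE (u j t x) - V (Torus.planarProj x)‖ ^ 2)) atTop (𝓝 0) →
        Tendsto (fun j => meanDissipation (ν j) (u j)) atTop (𝓝 0)) :=
  ⟨scalarNoAnomaly_of_condensate, twohalfdNeg_family_of_condensate⟩

end Summit.AnomalousDissipation.AnomalousDissipation.Theorems.TwohalfdNeg.Condensate
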